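import Summits.QuantumFields.QCD.Theses.HeavyThresholdYMBridge
import HarnessLib

/-!
# Route `HeavyThresholdYMBridge` (QCD): the assembly item (stmt-QuantumFields-17764) holds

`ThresholdQCD → ChiralCompletion → QCD`: apply the light-quark completion to the threshold data `(reg, M₀)` of the heavy-corner
thesis; it returns an offset `δ` at which the bare-mass trajectories `m ↦ m + δ` carry both the QCD body at every positive
tuple and chirality at zero; re-pinning `m_crit ↦ m_crit + a δ/Z_m` (same `Z_m`, so mass scaling is kept) makes these the
trajectories of an honest regularisation — `QCDOf N_f` for `N_f = 2, 3`.  Pure bookkeeping (`ring` on the bare-mass formula);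
the cruxes remain open; no summit statement beyond the item is proved (width seat ym-t4-w17 g0, free hands).
-/

set_option autoImplicit false

namespace Summit.QuantumFields.QCD.Theorems

open Literature.MathematicalPhysics.QuantumFieldTheory

/-- **Item stmt-QuantumFields-17764 `HeavyThresholdYMBridge.Assembly` holds.** [folklore] -/
theorem heavyThresholdYMBridge_assembly_proof :
    Summit.QuantumFields.QCD.Theses.HeavyThresholdYMBridge.Assembly := by
  intro hT hC
  have key : ∀ Nf : ℕ, Nf = 2 ∨ Nf = 3 → QCDOf Nf := by
    intro Nf hNf
    obtain ⟨M₀, -, reg, hms, hbody⟩ := hT Nf hNf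
    obtain ⟨δ, hchi, hb⟩ := hC Nf hNf reg M₀ hms hbody
    let reg₀ : QCDRegularisation Nf := { reg with mcrit := fun k => reg.mcrit k + reg.a k * δ / reg.Zm k }
    have hs : ∀ (m : Fin Nf → ℝ) (z shift : QCDField Nf → ℕ → ℝ),
        reg₀.scheme m z shift = reg.scheme (fun f => m f + δ) z shift := by
      intro m z shift
      simp only [reg₀, QCDRegularisation.scheme, QCDScheme.mk.injEq, true_and, and_true]
      funext f k
      ring
    refine ⟨reg₀, hms, fun ε hε => ?_, fun m hm => ?_⟩
    · obtain ⟨m, hm, hng⟩ := hchi ε hε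
      exact ⟨m, hm, by rw [hs]; exact hng⟩
    · obtain ⟨z, s, T, hT'⟩ := hb m hm
      exact ⟨z, s, T, by rw [hs]; exact hT'⟩
  exact ⟨key 2 (Or.inl rfl), key 3 (Or.inr rfl)⟩

end Summit.QuantumFields.QCD.Theorems
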